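import Literature.MathematicalPhysics.QuantumLattice.FermionQuasiFree
import HarnessLib

/-!
# Quasi-free Gibbs states of lattice fermions, III: imaginary-time two-point functions
(the free propagator at unequal times)

Topic `MathematicalPhysics/QuantumLattice`; continuation of `FermionQuasiFree.lean` (part I:
`dGamma`, the imaginary-time evolution `e^{s dΓ(h)} c^± e^{-s dΓ(h)}` of the fields, the Fermi
matrix `⟨c†_i c_j⟩_β = [(1 + e^{βh})⁻¹]_{ji}`). Benfatto–Giuliani–Mastropietro (Ann. Henri Poincaré
7 (2006) 809, the tree's fact `bgm_two_point_limit`) work with the imaginary-time fields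
`a^±_𝐱 = e^{Hx₀} a^±_{x⃗} e^{-Hx₀}` (eq. (1.2)) and the free propagator
`S₀(𝐱 - 𝐲) = ⟨T a⁻_𝐱 a⁺_𝐲⟩|_{U=0}` (eq. (1.4)); this file PROVES its closed form in every finite
volume, for a general Hermitian one-body matrix `h` and all complex times:

* `one_sub_fermiMatrix` — `1 - (1 + e^{βh})⁻¹ = (1 + e^{-βh})⁻¹`;
  `thermalCorr_dGamma_annihilation_creation'` — `⟨c_j c†_i⟩_β = [(1 + e^{-βh})⁻¹]_{ji}`;
* `thermalCorr_sum_smul_sum_smul` — bilinearity of `thermalCorr` on finite sums;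
* `thermalCorr_dGamma_evolve_annihilation_creation` —
  `⟨a⁻_j(s) a⁺_i(t)⟩_β = [e^{-sh} (1 + e^{-βh})⁻¹ e^{th}]_{ji}` (the `x₀ > y₀` branch of (1.4): in the
  eigenbasis of `h`, `e^{-τ(ε-μ)}/(1 + e^{-β(ε-μ)})`, `τ = x₀ - y₀`);
* `thermalCorr_dGamma_evolve_creation_annihilation` —
  `⟨a⁺_i(t) a⁻_j(s)⟩_β = [e^{-sh} (1 + e^{βh})⁻¹ e^{th}]_{ji}` (minus the `x₀ ≤ y₀` branch, the sign
  being the fermionic time-ordering sign of (1.3)).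

No definition and no named fact is introduced.

## References

* G. Benfatto, A. Giuliani, V. Mastropietro, Ann. Henri Poincaré 7 (2006) 809–898, §1.2,
  eqs. (1.2)–(1.4). [BenfattoGiulianiMastropietro2006]
* O. Bratteli, D. W. Robinson, *Operator Algebras and Quantum Statistical Mechanics 2*, 2nd ed.
  (Springer 1997), §5.2.4 (the ideal Fermi gas; quasi-free KMS state and its two-point function
  in time). [BratteliRobinsonII1997]
-/

noncomputable section

open NormedSpace Matrix Finset
open scoped ComplexOrder

namespace Literature.MathematicalPhysics.QuantumLattice

variable {ι : Type*} [LinearOrder ι] [Fintype ι]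

/-! ### Matrix identities for the Fermi matrices -/

/-- For Hermitian `h` and real `β`: `1 - (1 + e^{βh})⁻¹ = (1 + e^{-βh})⁻¹` (both equal
`e^{βh}(1 + e^{βh})⁻¹`). [folklore] -/
theorem one_sub_fermiMatrix {h : Matrix ι ι ℂ} (hh : h.IsHermitian) (β : ℝ) :
    1 - (1 + exp ((β : ℂ) • h))⁻¹ = (1 + exp (-((β : ℂ) • h)))⁻¹ := by
  set E := exp ((β : ℂ) • h) with hE
  have hEinv : exp (-((β : ℂ) • h)) * E = 1 := by
    rw [hE, ← Matrix.exp_add_of_commute (-((β : ℂ) • h)) ((β : ℂ) • h)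
      (Commute.refl ((β : ℂ) • h)).neg_left, neg_add_cancel, exp_zero]
  have h1 : IsUnit (1 + E).det :=
    ((posDef_one_add_exp_smul hh β).isUnit).map Matrix.detMonoidHom
  -- `(1 + e^{-βh}) (1 - (1+E)⁻¹) = 1`
  symm
  apply Matrix.inv_eq_right_inv
  have key : (1 + exp (-((β : ℂ) • h))) * (1 - (1 + E)⁻¹) * (1 + E) = 1 + E := by
    rw [Matrix.mul_assoc, Matrix.sub_mul, Matrix.one_mul, Matrix.nonsing_inv_mul _ h1,
      add_sub_cancel_left, Matrix.add_mul, Matrix.one_mul, hEinv, add_comm]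
  calc (1 + exp (-((β : ℂ) • h))) * (1 - (1 + E)⁻¹)
      = (1 + exp (-((β : ℂ) • h))) * (1 - (1 + E)⁻¹) * (1 + E) * (1 + E)⁻¹ := by
        rw [Matrix.mul_assoc _ (1 + E), Matrix.mul_nonsing_inv _ h1, Matrix.mul_one]
    _ = 1 := by rw [key, Matrix.mul_nonsing_inv _ h1]

/-- The complementary two-point function as a Fermi matrix: `⟨c_j c†_i⟩_β = [(1 + e^{-βh})⁻¹]_{ji}`.
Bratteli–Robinson II §5.2.4. [cite: BratteliRobinsonII1997, §5.2.4] -/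
theorem thermalCorr_dGamma_annihilation_creation' {h : Matrix ι ι ℂ} (hh : h.IsHermitian)
    (β : ℝ) (i j : ι) :
    thermalCorr β (dGamma h) (annihilation j) (creation i) = (1 + exp (-((β : ℂ) • h)))⁻¹ j i := by
  rw [thermalCorr_dGamma_annihilation_creation hh, ← one_sub_fermiMatrix hh β, Matrix.sub_apply,
    Matrix.one_apply, Matrix.one_apply]
  simp only [eq_comm]

/-! ### Two-point functions of imaginary-time evolved fields -/

/-- `thermalCorr` is additive and homogeneous in each argument (sums of scaled operators).
[folklore] -/
theorem thermalCorr_sum_smul_sum_smul {n : Type*} [Fintype n] [DecidableEq n] (β : ℝ)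
    (H : Matrix n n ℂ) {κ : Type*} [Fintype κ] (a b : κ → ℂ) (A B : κ → Matrix n n ℂ) :
    thermalCorr β H (∑ k, a k • A k) (∑ l, b l • B l) =
      ∑ k, ∑ l, a k * b l * thermalCorr β H (A k) (B l) := by
  simp only [thermalCorr, Finset.sum_mul, Finset.mul_sum, Matrix.smul_mul, Matrix.mul_smul,
    smul_smul, map_sum, LinearMap.map_smul, smul_eq_mul, mul_comm (b _) (a _)]
  rw [Finset.sum_comm]

/-- **The free propagator at unequal imaginary times, `τ = s - t` "positive" ordering**:
for Hermitian `h`, real `β` and `s, t ∈ ℂ`,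
`⟨(e^{s dΓ(h)} c_j e^{-s dΓ(h)}) (e^{t dΓ(h)} c†_i e^{-t dΓ(h)})⟩_β = [e^{-sh} (1 + e^{-βh})⁻¹ e^{th}]_{ji}`
(BGM's `S₀(𝐱 - 𝐲)` for `x₀ > y₀` at `U = 0`; in the one-body eigenbasis
`e^{-τ(ε-μ)} (1 + e^{-β(ε-μ)})⁻¹`, `τ = s - t`). BGM 2006 §1.2, eqs. (1.2)–(1.4); Bratteli–Robinson II
§5.2.4. [cite: BenfattoGiulianiMastropietro2006, eq. (1.4)] -/
theorem thermalCorr_dGamma_evolve_annihilation_creation {h : Matrix ι ι ℂ} (hh : h.IsHermitian)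
    (β : ℝ) (s t : ℂ) (i j : ι) :
    thermalCorr β (dGamma h)
        (exp (s • dGamma h) * annihilation j * exp (-(s • dGamma h)))
        (exp (t • dGamma h) * creation i * exp (-(t • dGamma h))) =
      (exp (-(s • h)) * (1 + exp (-((β : ℂ) • h)))⁻¹ * exp (t • h)) j i := by
  rw [exp_dGamma_mul_annihilation_mul_exp_neg, exp_dGamma_mul_creation_mul_exp_neg,
    thermalCorr_sum_smul_sum_smul]
  simp only [thermalCorr_dGamma_annihilation_creation' hh, Matrix.mul_apply, Finset.sum_mul]
  conv_rhs => rw [Finset.sum_comm]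
  refine Finset.sum_congr rfl fun k _ => Finset.sum_congr rfl fun l _ => ?_
  ring

/-- **The free propagator at unequal imaginary times, opposite ordering**:
`⟨(e^{t dΓ(h)} c†_i e^{-t dΓ(h)}) (e^{s dΓ(h)} c_j e^{-s dΓ(h)})⟩_β = [e^{-sh} (1 + e^{βh})⁻¹ e^{th}]_{ji}`
(minus BGM's `S₀(𝐱 - 𝐲)` for `x₀ ≤ y₀`, the sign being that of the time ordering (1.3); eigenvalues
`e^{-τ(ε-μ)} (1 + e^{β(ε-μ)})⁻¹`). BGM 2006 §1.2, eqs. (1.2)–(1.4); Bratteli–Robinson II §5.2.4.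
[cite: BenfattoGiulianiMastropietro2006, eq. (1.4)] -/
theorem thermalCorr_dGamma_evolve_creation_annihilation {h : Matrix ι ι ℂ} (hh : h.IsHermitian)
    (β : ℝ) (s t : ℂ) (i j : ι) :
    thermalCorr β (dGamma h)
        (exp (t • dGamma h) * creation i * exp (-(t • dGamma h)))
        (exp (s • dGamma h) * annihilation j * exp (-(s • dGamma h))) =
      (exp (-(s • h)) * (1 + exp ((β : ℂ) • h))⁻¹ * exp (t • h)) j i := by
  rw [exp_dGamma_mul_annihilation_mul_exp_neg, exp_dGamma_mul_creation_mul_exp_neg,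
    thermalCorr_sum_smul_sum_smul]
  simp only [thermalCorr_dGamma_creation_annihilation hh, Matrix.mul_apply, Finset.sum_mul]
  refine Finset.sum_congr rfl fun k _ => Finset.sum_congr rfl fun l _ => ?_
  ring

end Literature.MathematicalPhysics.QuantumLattice
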